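import Literature.Combinatorics.SimpleGraph.TreeRetractionGate            -- ★ `TreeLayers.root_equivariant`, `iterate_parent_height_mem` (the root of the retraction onto a subtree); brings ★ `TreeRetraction.exists_retraction`
import Literature.Combinatorics.SimpleGraph.TreeAutomorphismDisplacement   -- ★ `TreeDisplacement.dist_eq_length_of_isPath` (in a tree a path realises the distance)
import Literature.Combinatorics.SimpleGraph.TreeHereditaryLayerCount       -- ★ `TreeLayers.ncard_layer_one_eq_sum_of_hereditary` (the first layer above a subtree); brings ★ `TreeSubtreeLayerCount` (`ncard_layer_succ_eq_sum`, `finite_layer`, `type_eq_iff_even_dist`)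
import Literature.Combinatorics.SimpleGraph.LocallyFiniteBall              -- ★ `ClosedBall.finite_setOf_dist_le` (balls of a locally finite connected graph are finite)
import HarnessLib

/-!
# R90 · S6 — W8-f′ «INVERSION EDITION»: the displacement of a tree automorphism INVERTING AN EDGE — `d(x, φx) = 2·min(d(x,y), d(x,y′)) + 1`, no fixed vertex, and the shells
# `#{x : d(x, φx) = 2k+1} = 2·q^k` on a `(q+1)`-regular tree (`Theorems/R90S6TreeInversionDisplacement.lean`)

Cell `hodgecm-mathlib`, crux H413 (`stmt-HodgeConjecture-24833`), route of record `HCCMUnconditional`; programme R90-TF, section S6 (base `R90-C14`), seat K2E3-p28 (g4);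
dealer R90-C14-plan (g2) card W8-f′ (R90 bus 2026-09-05T02:54:05Z) — the organ K2Liu-p27 (g4)'s W11 FILE 2b waits on (odd `ord det δ` ⇒ `τ_δ` has no fixed vertex but an
inverted edge).  Helper lane `--supports stmt-HodgeConjecture-24833 --as helper`; THEOREMS ONLY (no definition, no instance, no notation, no named fact, no `sorry`);
generic graph theory over Mathlib + the ★ tree organs (`TreeRetractionOntoSubtree` ∕ `TreeRetractionGate` ∕ `TreeSubtreeLayerCount` ∕ `TreeHereditaryLayerCount` ∕
`TreeAutomorphismDisplacement`); the sibling of ★ W8-f `R90S6TreeDisplacementSphereCount` (the ELLIPTIC case `d(x, αx) = 2·d(x, Fix α)`).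

THE MATHEMATICS ([Serre1980Trees] I.6.1, I.6.4 Prop. 25 with `ℓ = 1` on the barycentric subdivision; II.1.3).  `G` a tree, `φ : G ≃g G` INVERTING the edge `y ~ y′`
(`φ y = y′`, `φ y′ = y`).  Retract `G` onto the subtree `Y = {y, y′}` (★ `exists_retraction`: height `h = d(·, Y)`, parent `p`, root `ρ = p^[h]`, all `φ`-equivariant since
`φ(Y) = Y`).  The root is a GATE (★ `dist_eq_height_add_dist_root`) so `h x = min(d(x,y), d(x,y′))`, and `ρ(φx) = φ(ρ x) ≠ ρ x` (the two roots `y ≠ y′` are exchanged) — in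
particular **`φ x ≠ x` for every `x`** (§2).  By induction on `h x`, `x — p x ⇝ φ(p x) — φ x` is a PATH of length `2·h x + 1` through the inverted edge (base: the edge `y — y′`
itself), hence the geodesic (★ `dist_eq_length_of_isPath`): **`d(x, φx) = 2·min(d(x,y), d(x,y′)) + 1`** (§2) — every displacement is ODD, and the displacement shell
`{d(x, φx) = 2k+1}` is the `k`-th LAYER above the edge.  On a `(q+1)`-REGULAR locally finite tree the layers above an edge count `2, 2q, 2q², …` (★ first-layer and
successor-layer counts), so **`#{x : d(x, φx) = 2k+1} = 2·q^k`, `#{x : d(x, φx) = 2k} = 0`** (§3).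
* §1 `connected_induce_pair_of_adj`, the inductive path `exists_path_two_mul_add_one_of_inversion`;
* §2 **`exists_height_of_inversion`** (the packaged statement), **`dist_self_apply_eq_of_inversion`** (I.1), `ne_self_of_inversion` (I.2), `odd_dist_self_apply_of_inversion`,
  `setOf_dist_self_apply_eq_even_of_inversion` (`= ∅`);
* §3 `ncard_layer_pair_eq_of_regular` (`#{x : min(d(x,y),d(x,y′)) = k} = 2·q^k`), **`ncard_dist_self_apply_eq_odd_of_inversion`** (I.3), `ncard_dist_self_apply_eq_even_of_inversion`,
  and the TYPED shells **`ncard_dist_self_apply_eq_odd_inter_type_of_inversion`** (`#{x : d(x, φx) = 2k+1 ∧ c x = i} = q^k` for a proper `2`-colouring `c`; (I.4) — a genuinely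
  bi-regular tree `q₀ ≠ q₁` admits no inversion, since `φ` preserves degrees, so the `(q+1)`-regular typed edition IS the bi-regular one).
HONEST LABEL: generic graph theory; proves no printed global statement, discharges no citation; count-neutral helper until W11 ∕ E1.3.5–E1.3.9 consume it.
HC_CM is proved only modulo the 7 printed citations (2 remaining named inputs: hLiu418 = stmt-HodgeConjecture-24832, h413 = stmt-HodgeConjecture-24833) until rung 0 closes; REL ≠ ★ ≠ BUILT.

## References
* [Serre1980Trees] J.-P. Serre, *Trees*, Springer (1980): I.2.3 (projection onto a subtree), I.6.1 (inversions), I.6.4 Prop. 24–25 (`d(x, φx) = 2·d(x, X_φ) + ℓ(φ)`), II.1.3.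
* [Diestel2010] R. Diestel, *Graph Theory*, 4th ed. (2010): Thm. 1.5.1 (unique paths in trees).
* [Meier2008] J. Meier, *Groups, Graphs and Trees*, CUP (2008): Thm. 3.46 (a fixed vertex or an inverted edge).
-/

set_option autoImplicit false
-- the mandated namespace repeats the single-problem summit's segment (`HodgeConjecture.HodgeConjecture`)
set_option linter.dupNamespace false

open SimpleGraph
open Literature.Combinatorics.SimpleGraph

namespace Summit.HodgeConjecture.HodgeConjecture.R90.S6

variable {V : Type*} {G : SimpleGraph V}

/-! ## §1 The retraction onto the inverted edge and the inductive path through it -/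

/-- An edge induces a connected subgraph on its two ends. [cite: Diestel2010, Thm. 1.5.1] -/
theorem connected_induce_pair_of_adj {y y' : V} (hyy' : G.Adj y y') : (G.induce ({y, y'} : Set V)).Connected := by
  refine induce_connected_of_patches y (Set.mem_insert y {y'}) fun {v} hv => ?_
  rcases hv with rfl | hv
  · exact ⟨{w | w ∈ (Walk.nil : G.Walk v v).support}, fun w hw => by
      rw [Set.mem_setOf_eq, Walk.support_nil, List.mem_singleton] at hw; rw [hw]; exact Set.mem_insert _ _,
      Walk.start_mem_support _, Walk.end_mem_support _, (Walk.connected_induce_support _).preconnected _ _⟩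
  · rw [Set.mem_singleton_iff] at hv
    subst hv
    refine ⟨{w | w ∈ (Walk.cons hyy' Walk.nil : G.Walk y v).support}, fun w hw => ?_,
      Walk.start_mem_support _, Walk.end_mem_support _, (Walk.connected_induce_support _).preconnected _ _⟩
    rw [Set.mem_setOf_eq, Walk.support_cons, Walk.support_nil, List.mem_cons, List.mem_singleton] at hw
    rcases hw with rfl | rfl
    · exact Set.mem_insert _ _
    · exact Set.mem_insert_of_mem _ rfl

/-- **The inductive path through the inverted edge.**  For `φ` exchanging the adjacent `y, y′`, height∕parent data toward `Y = {y, y′}` (`h v = 0 ↔ v ∈ Y`, a parent step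
`v ~ p v` with `h (p v) + 1 = h v` off `Y`, `h ∘ φ = h`) and `φ` fixing NO vertex: every `v` is joined to `φ v` by a PATH of length `2·h v + 1` whose vertices have height `≤ h v`
(`v — p v ⇝ φ(p v) — φ v`, starting from the edge `y — y′`). [cite: Serre1980Trees, I.6.4 Prop. 25] -/
theorem exists_path_two_mul_add_one_of_inversion (φ : G ≃g G) {y y' : V} (hyy' : G.Adj y y') (hφy : φ y = y') (hφy' : φ y' = y)
    (h : V → ℕ) (p : V → V) (h0 : ∀ v, h v = 0 ↔ v ∈ ({y, y'} : Set V)) (hp : ∀ v, v ∉ ({y, y'} : Set V) → G.Adj v (p v) ∧ h (p v) + 1 = h v)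
    (hφh : ∀ v, h (φ v) = h v) (hne : ∀ v, φ v ≠ v) :
    ∀ (n : ℕ) (v : V), h v = n → ∃ W : G.Walk v (φ v), W.IsPath ∧ W.length = 2 * n + 1 ∧ ∀ x ∈ W.support, h x ≤ n := by
  intro n
  induction n with
  | zero =>
    intro v hv
    have hvY : v ∈ ({y, y'} : Set V) := (h0 v).1 hv
    have hy0 : h y = 0 := (h0 y).2 (Set.mem_insert _ _)
    have hy'0 : h y' = 0 := (h0 y').2 (Set.mem_insert_of_mem _ rfl)
    rcases hvY with rfl | hvY
    · refine ⟨(Walk.cons hyy' Walk.nil).copy rfl hφy.symm, ?_, ?_, ?_⟩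
      · rw [Walk.isPath_copy, Walk.cons_isPath_iff]
        exact ⟨Walk.IsPath.nil, by rw [Walk.support_nil, List.mem_singleton]; exact hyy'.ne⟩
      · rw [Walk.length_copy, Walk.length_cons, Walk.length_nil]
      · intro x hx
        rw [Walk.support_copy, Walk.support_cons, Walk.support_nil, List.mem_cons, List.mem_singleton] at hx
        rcases hx with rfl | rfl
        · exact hy0.le
        · exact hy'0.le
    · rw [Set.mem_singleton_iff] at hvY
      subst hvY
      refine ⟨(Walk.cons hyy'.symm Walk.nil).copy rfl hφy'.symm, ?_, ?_, ?_⟩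
      · rw [Walk.isPath_copy, Walk.cons_isPath_iff]
        exact ⟨Walk.IsPath.nil, by rw [Walk.support_nil, List.mem_singleton]; exact hyy'.symm.ne⟩
      · rw [Walk.length_copy, Walk.length_cons, Walk.length_nil]
      · intro x hx
        rw [Walk.support_copy, Walk.support_cons, Walk.support_nil, List.mem_cons, List.mem_singleton] at hx
        rcases hx with rfl | rfl
        · exact hv.le
        · exact hy0.le
  | succ n ih =>
    intro v hv
    have hvY : v ∉ ({y, y'} : Set V) := fun hmem => by
      have := (h0 v).2 hmem
      omega
    obtain ⟨hadj, hpu⟩ := hp v hvY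
    have hu : h (p v) = n := by omega
    obtain ⟨W, hWp, hWl, hWs⟩ := ih (p v) hu
    -- the new ends are not on `W` (their height is `n + 1`)
    have hv_notin : v ∉ W.support := fun hx => by have := hWs v hx; omega
    have hφv_notin : φ v ∉ W.support := fun hx => by have := hWs (φ v) hx; rw [hφh] at this; omega
    have hadj' : G.Adj (φ (p v)) (φ v) := (φ.map_adj_iff).2 hadj.symm
    have hcat : (W.concat hadj').IsPath := hWp.concat hφv_notin hadj'
    refine ⟨Walk.cons hadj (W.concat hadj'), ?_, ?_, ?_⟩
    · rw [Walk.cons_isPath_iff]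
      refine ⟨hcat, ?_⟩
      rw [Walk.support_concat, List.mem_append, List.mem_singleton, not_or]
      exact ⟨hv_notin, fun heq => hne v heq.symm⟩
    · rw [Walk.length_cons, Walk.length_concat, hWl]
      ring
    · intro x hx
      rw [Walk.support_cons, List.mem_cons, Walk.support_concat, List.mem_append, List.mem_singleton] at hx
      rcases hx with rfl | hx | rfl
      · omega
      · exact (hWs x hx).trans (Nat.le_succ n)
      · rw [hφh]; omega

/-! ## §2 `d(x, φx) = 2·min(d(x,y), d(x,y′)) + 1`: no fixed vertex, odd displacements -/

/-- **THE DISPLACEMENT OF AN INVERSION** ([Serre1980Trees] I.6.4 Prop. 25 at `ℓ = 1`): for a tree `G` and `φ : G ≃g G` exchanging the adjacent vertices `y, y′` there is a height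
function `h` with `h v = min(d(v,y), d(v,y′))` (the distance to the inverted edge, attained and minimal), `h v = 0 ↔ v ∈ {y, y′}`, `h (φ v) = h v`, **`φ v ≠ v`** and
**`G.dist v (φ v) = 2 * h v + 1`** for every vertex `v`.  (Heights∕parents∕roots from ★ `TreeRetraction.exists_retraction` onto the edge; `φ v ≠ v` because the root is
equivariant, ★ `TreeLayers.root_equivariant`, and `φ` exchanges the two roots; the path of §1 is the geodesic by uniqueness of paths in a tree.)
[cite: Serre1980Trees, I.6.4 Prop. 25] [cite: Meier2008, Thm. 3.46] -/
theorem exists_height_of_inversion (hT : G.IsTree) (φ : G ≃g G) {y y' : V} (hyy' : G.Adj y y') (hφy : φ y = y') (hφy' : φ y' = y) :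
    ∃ h : V → ℕ, (∀ v, h v = min (G.dist v y) (G.dist v y')) ∧ (∀ v, h v = 0 ↔ v ∈ ({y, y'} : Set V)) ∧ (∀ v, h (φ v) = h v) ∧
      (∀ v, φ v ≠ v) ∧ ∀ v, G.dist v (φ v) = 2 * h v + 1 := by
  have hc : G.Connected := hT.1
  have hYne : (({y, y'} : Set V)).Nonempty := ⟨y, Set.mem_insert _ _⟩
  have hYc : (G.induce ({y, y'} : Set V)).Connected := connected_induce_pair_of_adj hyy'
  obtain ⟨h, p, hdist, h0, hpar, -, hchild, hequi⟩ := TreeRetraction.exists_retraction hT hYne hYc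
  have hφY : ∀ v, φ v ∈ ({y, y'} : Set V) ↔ v ∈ ({y, y'} : Set V) := by
    intro v
    simp only [Set.mem_insert_iff, Set.mem_singleton_iff]
    constructor
    · rintro (hv | hv)
      · right; apply φ.injective; rw [hv, hφy']
      · left; apply φ.injective; rw [hv, hφy]
    · rintro (rfl | rfl)
      · right; exact hφy
      · left; exact hφy'
  have hequi' := hequi φ hφY
  have hφh : ∀ v, h (φ v) = h v := fun v => (hequi' v).1
  -- the height is the distance to the nearer end of the edge
  have hmin : ∀ v, h v = min (G.dist v y) (G.dist v y') := by
    intro v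
    obtain ⟨⟨y₀, hy₀, hd₀⟩, hle⟩ := hdist v
    refine le_antisymm (le_min (hle y (Set.mem_insert _ _)) (hle y' (Set.mem_insert_of_mem _ rfl))) ?_
    rcases hy₀ with rfl | hy₀
    · rw [← hd₀]; exact min_le_left _ _
    · rw [Set.mem_singleton_iff] at hy₀
      subst hy₀
      rw [← hd₀]; exact min_le_right _ _
  -- no vertex is fixed: the root is equivariant and `φ` exchanges the two roots
  have hne : ∀ v, φ v ≠ v := by
    intro v hv
    have hroot := TreeLayers.root_equivariant h0 hpar φ hequi' v
    rw [hv] at hroot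
    have hmem : p^[h v] v ∈ ({y, y'} : Set V) := TreeLayers.iterate_parent_height_mem h0 hpar v
    rcases hmem with hr | hr
    · rw [hr, hφy] at hroot
      exact hyy'.ne hroot
    · rw [Set.mem_singleton_iff] at hr
      rw [hr, hφy'] at hroot
      exact hyy'.ne hroot.symm
  refine ⟨h, hmin, h0, hφh, hne, fun v => ?_⟩
  obtain ⟨W, hW, hWl, -⟩ := exists_path_two_mul_add_one_of_inversion φ hyy' hφy hφy' h p h0 (fun v hv => hpar v hv) hφh hne (h v) v rfl
  rw [TreeDisplacement.dist_eq_length_of_isPath hT hW, hWl]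

/-- **(I.1) `d(x, φx) = 2·min(d(x,y), d(x,y′)) + 1`** for a tree automorphism `φ` exchanging the adjacent vertices `y, y′`. [cite: Serre1980Trees, I.6.4 Prop. 25] -/
theorem dist_self_apply_eq_of_inversion (hT : G.IsTree) (φ : G ≃g G) {y y' : V} (hyy' : G.Adj y y') (hφy : φ y = y') (hφy' : φ y' = y) (x : V) :
    G.dist x (φ x) = 2 * min (G.dist x y) (G.dist x y') + 1 := by
  obtain ⟨h, hmin, -, -, -, hd⟩ := exists_height_of_inversion hT φ hyy' hφy hφy'
  rw [hd x, hmin x]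

/-- **(I.2) AN INVERSION FIXES NO VERTEX**: `φ x ≠ x` for every `x`. [cite: Serre1980Trees, I.6.1] [cite: Meier2008, Thm. 3.46] -/
theorem ne_self_of_inversion (hT : G.IsTree) (φ : G ≃g G) {y y' : V} (hyy' : G.Adj y y') (hφy : φ y = y') (hφy' : φ y' = y) (x : V) : φ x ≠ x := by
  obtain ⟨h, -, -, -, hne, -⟩ := exists_height_of_inversion hT φ hyy' hφy hφy'
  exact hne x

/-- Every displacement of an inversion is ODD. [cite: Serre1980Trees, I.6.4 Prop. 25] -/
theorem odd_dist_self_apply_of_inversion (hT : G.IsTree) (φ : G ≃g G) {y y' : V} (hyy' : G.Adj y y') (hφy : φ y = y') (hφy' : φ y' = y) (x : V) :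
    Odd (G.dist x (φ x)) :=
  ⟨min (G.dist x y) (G.dist x y'), dist_self_apply_eq_of_inversion hT φ hyy' hφy hφy' x⟩

/-- THE SHELL DICTIONARY, odd shells: `{x | d(x, φx) = 2k+1} = {x | min(d(x,y), d(x,y′)) = k}` (the `k`-th layer above the inverted edge). [cite: Serre1980Trees, I.6.4 Prop. 25] -/
theorem setOf_dist_self_apply_eq_odd_of_inversion (hT : G.IsTree) (φ : G ≃g G) {y y' : V} (hyy' : G.Adj y y') (hφy : φ y = y') (hφy' : φ y' = y) (k : ℕ) :
    {x | G.dist x (φ x) = 2 * k + 1} = {x | min (G.dist x y) (G.dist x y') = k} := by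
  ext x
  simp only [Set.mem_setOf_eq, dist_self_apply_eq_of_inversion hT φ hyy' hφy hφy' x]
  omega

/-- THE SHELL DICTIONARY, even shells are EMPTY: `{x | d(x, φx) = 2k} = ∅`. [cite: Serre1980Trees, I.6.4 Prop. 25] -/
theorem setOf_dist_self_apply_eq_even_of_inversion (hT : G.IsTree) (φ : G ≃g G) {y y' : V} (hyy' : G.Adj y y') (hφy : φ y = y') (hφy' : φ y' = y) (k : ℕ) :
    {x | G.dist x (φ x) = 2 * k} = ∅ := by
  ext x
  simp only [Set.mem_setOf_eq, Set.mem_empty_iff_false, iff_false, dist_self_apply_eq_of_inversion hT φ hyy' hφy hφy' x]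
  omega

/-! ## §3 The layers above an edge of a `(q+1)`-regular tree: `#{x : min(d(x,y), d(x,y′)) = k} = 2·q^k`, hence `#{x : d(x, φx) = 2k+1} = 2·q^k` -/

/-- **THE LAYERS ABOVE AN EDGE OF A `(q+1)`-REGULAR TREE**: `#{x | min(d(x,y), d(x,y′)) = k} = 2·q^k` (`y ~ y′`; locally finite, every vertex of degree `q + 1`): the layer `0` is
the edge itself, the first layer the `2q` other neighbours of its ends (★ `ncard_layer_one_eq_sum_of_hereditary`), and each further layer has `q` children per vertex
(★ `ncard_layer_succ_eq_sum`). [cite: Serre1980Trees, I.2.3, II.1.3] -/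
theorem ncard_layer_pair_eq_of_regular [G.LocallyFinite] (hT : G.IsTree) {y y' : V} (hyy' : G.Adj y y') (q : ℕ) (hdeg : ∀ v, G.degree v = q + 1) (k : ℕ) :
    {x | min (G.dist x y) (G.dist x y') = k}.ncard = 2 * q ^ k := by
  classical
  have hc : G.Connected := hT.1
  have hYne : (({y, y'} : Set V)).Nonempty := ⟨y, Set.mem_insert _ _⟩
  have hYc : (G.induce ({y, y'} : Set V)).Connected := connected_induce_pair_of_adj hyy'
  have hYfin : (({y, y'} : Set V)).Finite := (Set.finite_singleton y').insert y
  obtain ⟨h, p, hdist, h0, hpar, -, hchild, -⟩ := TreeRetraction.exists_retraction hT hYne hYc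
  -- the height is the distance to the nearer end of the edge
  have hmin : ∀ v, h v = min (G.dist v y) (G.dist v y') := by
    intro v
    obtain ⟨⟨y₀, hy₀, hd₀⟩, hle⟩ := hdist v
    refine le_antisymm (le_min (hle y (Set.mem_insert _ _)) (hle y' (Set.mem_insert_of_mem _ rfl))) ?_
    rcases hy₀ with rfl | hy₀
    · rw [← hd₀]; exact min_le_left _ _
    · rw [Set.mem_singleton_iff] at hy₀
      subst hy₀
      rw [← hd₀]; exact min_le_right _ _
  have hset : ∀ k, {x | min (G.dist x y) (G.dist x y') = k} = {x | h x = k} := fun k => by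
    ext x; rw [Set.mem_setOf_eq, Set.mem_setOf_eq, hmin]
  rw [hset]
  -- layer 0: the edge; layer 1: the `2q` other neighbours; layer `k+1 = q ·` layer `k` for `k ≥ 1`
  have hne : y ≠ y' := hyy'.ne
  have hL0 : {x | h x = 0}.ncard = 2 := by
    have e : {x | h x = 0} = ({y, y'} : Set V) := by ext x; rw [Set.mem_setOf_eq, h0]
    rw [e, Set.ncard_insert_of_notMem (by rwa [Set.mem_singleton_iff]) (Set.finite_singleton y'), Set.ncard_singleton]
  -- the neighbours of an end outside the edge: all but the other end
  have hnb : ((G.neighborFinset y).filter (fun w => w ∉ ({y, y'} : Set V))).card = q := by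
    have hsub : (G.neighborFinset y).filter (fun w => w ∉ ({y, y'} : Set V)) = (G.neighborFinset y).erase y' := by
      ext w
      simp only [Finset.mem_filter, Finset.mem_erase, mem_neighborFinset, Set.mem_insert_iff, Set.mem_singleton_iff, not_or]
      constructor
      · rintro ⟨hw, -, hwb⟩; exact ⟨hwb, hw⟩
      · rintro ⟨hwb, hw⟩; exact ⟨hw, fun hwa => hw.ne' hwa, hwb⟩
    rw [hsub, Finset.card_erase_of_mem ((mem_neighborFinset _ _ _).2 hyy'), card_neighborFinset_eq_degree, hdeg]
    omega
  have hnb' : ((G.neighborFinset y').filter (fun w => w ∉ ({y, y'} : Set V))).card = q := by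
    have hsub : (G.neighborFinset y').filter (fun w => w ∉ ({y, y'} : Set V)) = (G.neighborFinset y').erase y := by
      ext w
      simp only [Finset.mem_filter, Finset.mem_erase, mem_neighborFinset, Set.mem_insert_iff, Set.mem_singleton_iff, not_or]
      constructor
      · rintro ⟨hw, hwa, -⟩; exact ⟨hwa, hw⟩
      · rintro ⟨hwa, hw⟩; exact ⟨hw, hwa, fun hwb => hw.ne' hwb⟩
    rw [hsub, Finset.card_erase_of_mem ((mem_neighborFinset _ _ _).2 hyy'.symm), card_neighborFinset_eq_degree, hdeg]
    omega
  have hL1 : {x | h x = 1}.ncard = 2 * q := by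
    have hD : {v | v ∈ ({y, y'} : Set V) ∧ True}.Finite := hYfin.subset fun v hv => hv.1
    have e1 : {x | h x = 1} = {x | h x = 1 ∧ True} := by ext x; simp only [Set.mem_setOf_eq, and_true]
    rw [e1, TreeLayers.ncard_layer_one_eq_sum_of_hereditary h0 hpar hchild (P := fun _ => True) (fun _ _ => Iff.rfl) hD]
    have hDs : hD.toFinset = {y, y'} := by
      ext v
      simp only [Set.Finite.mem_toFinset, Set.mem_setOf_eq, and_true, Set.mem_insert_iff, Set.mem_singleton_iff, Finset.mem_insert, Finset.mem_singleton]
    rw [hDs, Finset.sum_pair hne, hnb, hnb']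
    ring
  have hLsucc : ∀ k, 1 ≤ k → {x | h x = k + 1}.ncard = q * {x | h x = k}.ncard := by
    intro k hk
    rw [TreeLayers.ncard_layer_succ_eq_sum h0 hpar hchild hYfin hk, Finset.sum_congr rfl fun v _ => by rw [hdeg v, Nat.add_sub_cancel],
      Finset.sum_const, smul_eq_mul, mul_comm, Set.ncard_eq_toFinset_card _ (TreeLayers.finite_layer h0 hpar hchild hYfin k)]
  -- induction
  induction k with
  | zero => rw [hL0, pow_zero, mul_one]
  | succ k ih =>
    rcases Nat.eq_zero_or_pos k with rfl | hk
    · rw [hL1, pow_one]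
    · rw [hLsucc k hk, ih, pow_succ]
      ring

/-- **(I.3) THE DISPLACEMENT SHELLS OF AN INVERSION ON A `(q+1)`-REGULAR TREE: `#{x | d(x, φx) = 2k+1} = 2·q^k`** (`φ` exchanging the adjacent `y, y′`; locally finite, every
vertex of degree `q + 1` — the tree of `SL₂(F)` ∕ `U(1,1)(F)` at an inert place, `q = q_F`). [cite: Serre1980Trees, I.6.4 Prop. 25; II.1.3] -/
theorem ncard_dist_self_apply_eq_odd_of_inversion [G.LocallyFinite] (hT : G.IsTree) (φ : G ≃g G) {y y' : V} (hyy' : G.Adj y y') (hφy : φ y = y') (hφy' : φ y' = y)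
    (q : ℕ) (hdeg : ∀ v, G.degree v = q + 1) (k : ℕ) :
    {x | G.dist x (φ x) = 2 * k + 1}.ncard = 2 * q ^ k := by
  rw [setOf_dist_self_apply_eq_odd_of_inversion hT φ hyy' hφy hφy' k, ncard_layer_pair_eq_of_regular hT hyy' q hdeg k]

/-- **THE EVEN SHELLS OF AN INVERSION ARE EMPTY: `#{x | d(x, φx) = 2k} = 0`.** [cite: Serre1980Trees, I.6.4 Prop. 25] -/
theorem ncard_dist_self_apply_eq_even_of_inversion (hT : G.IsTree) (φ : G ≃g G) {y y' : V} (hyy' : G.Adj y y') (hφy : φ y = y') (hφy' : φ y' = y) (k : ℕ) :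
    {x | G.dist x (φ x) = 2 * k}.ncard = 0 := by
  rw [setOf_dist_self_apply_eq_even_of_inversion hT φ hyy' hφy hφy' k, Set.ncard_empty]


/-- **THE TYPED SHELLS OF AN INVERSION: `#{x | d(x, φx) = 2k+1 ∧ c x = i} = q^k`** for each type `i` of a proper `2`-colouring `c` of a `(q+1)`-regular tree (the two vertex types
of the unramified `U(1,1)` tree): `φ` maps the type-`0` part of the shell bijectively onto its type-`1` part (an odd displacement changes the type, ★ `type_eq_iff_even_dist`), and the
two parts partition the shell of size `2·q^k`. [cite: Serre1980Trees, I.6.4 Prop. 25; II.1.3] -/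
theorem ncard_dist_self_apply_eq_odd_inter_type_of_inversion [G.LocallyFinite] (hT : G.IsTree) (φ : G ≃g G) {y y' : V} (hyy' : G.Adj y y') (hφy : φ y = y')
    (hφy' : φ y' = y) (q : ℕ) (hdeg : ∀ v, G.degree v = q + 1) (c : V → Fin 2) (hc : ∀ v w, G.Adj v w → c v ≠ c w) (k : ℕ) (i : Fin 2) :
    {x | G.dist x (φ x) = 2 * k + 1 ∧ c x = i}.ncard = q ^ k := by
  classical
  have hc' : G.Connected := hT.1
  -- an odd displacement changes the type
  have hswap : ∀ x, G.dist x (φ x) = 2 * k + 1 → c (φ x) ≠ c x := by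
    intro x hx hEq
    have hev := (TreeLayers.type_eq_iff_even_dist hT x c hc (φ x)).1 hEq
    rw [hx] at hev
    exact (Nat.not_even_iff_odd.2 ⟨k, rfl⟩) hev
  have hother : ∀ {a b : Fin 2}, a ≠ b → ∀ t : Fin 2, t ≠ a → t = b := by decide
  -- `φ` maps the type-`a` part of the shell onto the type-`b` part (`a ≠ b`)
  have himage : ∀ {a b : Fin 2}, a ≠ b →
      φ '' {x | G.dist x (φ x) = 2 * k + 1 ∧ c x = a} = {x | G.dist x (φ x) = 2 * k + 1 ∧ c x = b} := by
    intro a b hab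
    ext z
    simp only [Set.mem_image, Set.mem_setOf_eq]
    constructor
    · rintro ⟨x, ⟨hx, hxa⟩, rfl⟩
      refine ⟨by rw [TreeLayers.dist_iso_apply φ x (φ x)]; exact hx, hother hab _ ?_⟩
      rw [← hxa]; exact hswap x hx
    · rintro ⟨hz, hzb⟩
      have hz' : G.dist (φ.symm z) (φ (φ.symm z)) = 2 * k + 1 := by
        rw [← TreeLayers.dist_iso_apply φ (φ.symm z) (φ (φ.symm z)), RelIso.apply_symm_apply]; exact hz
      refine ⟨φ.symm z, ⟨hz', hother hab.symm _ ?_⟩, RelIso.apply_symm_apply φ z⟩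
      intro hEq
      have h1 := hswap (φ.symm z) hz'
      rw [RelIso.apply_symm_apply, hzb] at h1
      exact h1 hEq.symm
  have hsame : ∀ {a b : Fin 2}, a ≠ b →
      {x | G.dist x (φ x) = 2 * k + 1 ∧ c x = a}.ncard = {x | G.dist x (φ x) = 2 * k + 1 ∧ c x = b}.ncard := fun {a b} hab => by
    rw [← himage hab, Set.ncard_image_of_injective _ φ.injective]
  -- the two parts partition the shell, which is finite (inside the ball of radius `k + 1` about `y`) of size `2·q^k`
  have hfin : {x | G.dist x (φ x) = 2 * k + 1}.Finite := by
    refine (ClosedBall.finite_setOf_dist_le (fun v => (G.neighborSet v).toFinite) hc' y (k + 1)).subset fun x hx => ?_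
    rw [Set.mem_setOf_eq, dist_self_apply_eq_of_inversion hT φ hyy' hφy hφy' x] at hx
    rw [Set.mem_setOf_eq, SimpleGraph.dist_comm]
    have h1 : G.dist x y ≤ G.dist x y' + 1 := by
      calc G.dist x y ≤ G.dist x y' + G.dist y' y := hc'.dist_triangle
        _ = G.dist x y' + 1 := by rw [SimpleGraph.dist_eq_one_iff_adj.2 hyy'.symm]
    rcases min_cases (G.dist x y) (G.dist x y') with ⟨hm, -⟩ | ⟨hm, -⟩ <;> omega
  have hunion : {x | G.dist x (φ x) = 2 * k + 1} =
      {x | G.dist x (φ x) = 2 * k + 1 ∧ c x = 0} ∪ {x | G.dist x (φ x) = 2 * k + 1 ∧ c x = 1} := by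
    ext x
    simp only [Set.mem_setOf_eq, Set.mem_union]
    have hfin2 : ∀ t : Fin 2, t = 0 ∨ t = 1 := by decide
    constructor
    · intro hx
      rcases hfin2 (c x) with h | h
      · exact Or.inl ⟨hx, h⟩
      · exact Or.inr ⟨hx, h⟩
    · rintro (⟨hx, -⟩ | ⟨hx, -⟩) <;> exact hx
  have hdisj : Disjoint {x | G.dist x (φ x) = 2 * k + 1 ∧ c x = 0} {x | G.dist x (φ x) = 2 * k + 1 ∧ c x = 1} := by
    rw [Set.disjoint_left]
    rintro x ⟨-, h0⟩ ⟨-, h1⟩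
    rw [h0] at h1
    exact absurd h1 (by decide)
  have htot := ncard_dist_self_apply_eq_odd_of_inversion hT φ hyy' hφy hφy' q hdeg k
  rw [hunion, Set.ncard_union_eq hdisj (hfin.subset fun x hx => hx.1) (hfin.subset fun x hx => hx.1),
    hsame Fin.zero_ne_one] at htot
  have h1 : {x | G.dist x (φ x) = 2 * k + 1 ∧ c x = 1}.ncard = q ^ k := by omega
  have hfin2 : ∀ t : Fin 2, t = 0 ∨ t = 1 := by decide
  rcases hfin2 i with rfl | rfl
  · rw [hsame Fin.zero_ne_one, h1]
  · exact h1

end Summit.HodgeConjecture.HodgeConjecture.R90.S6
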